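import Summits.PneNP.PneNP.Theses.RootDecompKtPerebor
import Summits.PneNP.PneNP.Theorems.RootDecompKtPereborPereborLawConstruction

/-!
# `RootDecompKtPerebor.PereborLawTwo` (stmt-PneNP-29375) — the PEREBOR LAW at exponent K = 2, in kernel (part B)

Continues `RootDecompKtPereborPereborLawConstruction.lean` (part A: the TABLE ∪ PADDED-QUERY circuit at
one length).  THIS FILE ports the lens kernel's arithmetic (`LawArith.*`: `m ≤ 2A·2^{s−γ}`,
`m^K ≤ (3A)^K·2^γ` from `K(s−γ) ≤ γ`, `log₂ m + 1 ≤ 3A`, `3A ≤ (36 + 6 c_print)·N`) and the law itself,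
`pereborLaw_holds` (stated with the lens's `PereborLaw K` / `FixedPolylogSize` / `KtEasy` unfolded: `W_U ∈ SIZE(c n^K (log n+1)^c + c) ⟹ ∀ s ∃ c', MKtP_U[s] ∈ SIZE(pereborBound (K/(K+1)) s c')`) — cases `N ≤ n₀` (Shannon bound), `s(N) > 3N + c_print` (every string
of length `N` is in the slice by cheap printing: the constant circuit), otherwise the part-A circuit at
level `γ = ⌈K s(N)/(K+1)⌉` — verbatim from HOME/decomp-pnenp-lens-3/KtPereborDial.lean sha256 844e006f…
(critic CLEARED 06:14:40Z), and then lands the route item `PereborLawTwo` (the `K = 2` instance, filed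
provable-now; census tribunal batch 1: «land PereborLawTwo 29375 so the law is a tree theorem») by the
one-line instantiation.  0 sorry.
[cite: HiraharaIlangoWilliams2024] [cite: AroraBarak2009]
-/

namespace Summit.PneNP.PneNP.Theorems.RootDecompKtPereborPort

open _root_.Computability Literature.Computability.Complexity Literature.Computability.MetaComplexity
open Filter Topology Nondeterministic
open Summit.PneNP.PneNP.Theorems

/-! ## The PEREBOR LAW in KERNEL, part 3: the arithmetic, and `theorem pereborLaw_holds : ∀ K, PereborLaw K` -/

namespace LawArith


/-- `m ≤ 2A·2^{σ-γ}`. -/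
theorem m_le (N σ γ cP : ℕ) (hσ : σ ≤ 3 * N + cP) :
    2 * N + 2 + (2 * σ + 2 + 2 ^ (σ - γ - 1)) ≤ 2 * (8 * N + 2 * cP + 4) * 2 ^ (σ - γ) := by
  set A := 8 * N + 2 * cP + 4 with hA
  set b := 2 ^ (σ - γ - 1) with hb
  have hb1 : 1 ≤ b := Nat.one_le_two_pow
  have hA1 : 1 ≤ A := by omega
  have hbb : b ≤ 2 ^ (σ - γ) := Nat.pow_le_pow_right (by norm_num) (by omega)
  have h1 : 2 * N + 2 + (2 * σ + 2 + b) ≤ A + b := by omega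
  have h2 : A + b ≤ 2 * A * b := by nlinarith
  calc 2 * N + 2 + (2 * σ + 2 + b) ≤ 2 * A * b := h1.trans h2
    _ ≤ 2 * A * 2 ^ (σ - γ) := Nat.mul_le_mul_left _ hbb

/-- `K(σ-γ) ≤ γ` from `Kσ ≤ (K+1)γ`. -/
theorem K_mul_sub_le (K σ γ : ℕ) (h : K * σ ≤ (K + 1) * γ) : K * (σ - γ) ≤ γ := by
  rcases Nat.lt_or_ge σ γ with hlt | hle
  · rw [Nat.sub_eq_zero_of_le hlt.le]; simp
  · obtain ⟨d, rfl⟩ := Nat.exists_eq_add_of_le hle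
    rw [Nat.add_sub_cancel_left]
    have : K * γ + K * d ≤ K * γ + γ := by
      have e1 : K * (γ + d) = K * γ + K * d := by ring
      have e2 : (K + 1) * γ = K * γ + γ := by ring
      rw [e1, e2] at h; exact h
    omega

/-- `log₂ m + 1 ≤ 3A`. -/
theorem log_le (m A σ : ℕ) (hm : m ≤ 2 * A * 2 ^ σ) (hA : σ + 1 ≤ A) (hm0 : m ≠ 0) :
    Nat.log 2 m + 1 ≤ 3 * A := by
  have h1 : 2 ^ Nat.log 2 m ≤ m := Nat.pow_log_le_self 2 hm0
  have h2 : 2 * A ≤ 2 ^ (2 * A) := (Nat.lt_two_pow_self).le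
  have h3 : 2 ^ Nat.log 2 m ≤ 2 ^ (2 * A + σ) := by
    calc 2 ^ Nat.log 2 m ≤ m := h1
      _ ≤ 2 * A * 2 ^ σ := hm
      _ ≤ 2 ^ (2 * A) * 2 ^ σ := Nat.mul_le_mul_right _ h2
      _ = 2 ^ (2 * A + σ) := by rw [pow_add]
  have h4 : Nat.log 2 m ≤ 2 * A + σ := (Nat.pow_le_pow_iff_right (by norm_num)).1 h3
  omega

/-- the ceiling fact: `γ = ⌈K/(K+1)·σ⌉₊ ⟹ Kσ ≤ (K+1)γ`. -/
theorem ceil_fact (K σ : ℕ) : K * σ ≤ (K + 1) * ⌈(K : ℝ) / (K + 1) * (σ : ℝ)⌉₊ := by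
  set γ := ⌈(K : ℝ) / (K + 1) * (σ : ℝ)⌉₊ with hγ
  have h1 : (K : ℝ) / (K + 1) * σ ≤ γ := Nat.le_ceil _
  have hK : (0 : ℝ) < K + 1 := by positivity
  have h2 : (K : ℝ) * σ ≤ (K + 1) * γ := by
    have := mul_le_mul_of_nonneg_left h1 hK.le
    calc (K : ℝ) * σ = (K + 1) * ((K : ℝ) / (K + 1) * σ) := by field_simp
      _ ≤ (K + 1) * γ := this
  exact_mod_cast h2



/-- The law's arithmetic: one constant `c` dominating the table + padded-query size. -/
theorem total_le (K c₀ cP B : ℕ) : ∃ c : ℕ, B ≤ c ∧ 1 ≤ c ∧ ∀ N σ γ : ℕ, 1 ≤ N → σ ≤ 3 * N + cP →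
    K * σ ≤ (K + 1) * γ →
    2 ^ (γ + 1) * (2 * N + 2) + 4 +
      (c₀ * (padLen σ γ N) ^ K * (Nat.log 2 (padLen σ γ N) + 1) ^ c₀ + c₀)
      ≤ c * 2 ^ γ * N ^ c + c := by
  set e := K + c₀ + 1 with he
  refine ⟨(c₀ + 1) * (36 + 6 * cP) ^ e + e + c₀ + 4 + B, by omega, by omega, ?_⟩
  intro N σ γ hN hσ hKσ
  set c := (c₀ + 1) * (36 + 6 * cP) ^ e + e + c₀ + 4 + B with hc
  set m := padLen σ γ N with hm
  set A := 8 * N + 2 * cP + 4 with hA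
  have hm_le : m ≤ 2 * A * 2 ^ (σ - γ) := by rw [hm]; unfold padLen; exact m_le N σ γ cP hσ
  have hK : K * (σ - γ) ≤ γ := K_mul_sub_le K σ γ hKσ
  have hA1 : 1 ≤ 3 * A := by omega
  -- m^K ≤ (2A)^K 2^γ ≤ (3A)^K 2^γ
  have hmK : m ^ K ≤ (3 * A) ^ K * 2 ^ γ := by
    calc m ^ K ≤ (2 * A * 2 ^ (σ - γ)) ^ K := Nat.pow_le_pow_left hm_le K
      _ = (2 * A) ^ K * 2 ^ ((σ - γ) * K) := by rw [mul_pow, ← pow_mul]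
      _ ≤ (3 * A) ^ K * 2 ^ γ := by
          apply Nat.mul_le_mul
          · exact Nat.pow_le_pow_left (by omega) K
          · exact Nat.pow_le_pow_right (by norm_num) (by rw [Nat.mul_comm]; exact hK)
  -- log₂ m + 1 ≤ 3A
  have hlog : Nat.log 2 m + 1 ≤ 3 * A :=
    log_le m A (σ - γ) hm_le (by have : σ - γ ≤ σ := Nat.sub_le σ γ; omega)
      (by have : 1 ≤ 2 ^ (σ - γ - 1) := Nat.one_le_two_pow; rw [hm]; unfold padLen; omega)
  have hlogc : (Nat.log 2 m + 1) ^ c₀ ≤ (3 * A) ^ c₀ := Nat.pow_le_pow_left hlog c₀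
  -- the W part
  have hWpart : c₀ * m ^ K * (Nat.log 2 m + 1) ^ c₀ + c₀ ≤ c₀ * (3 * A) ^ e * 2 ^ γ + c₀ := by
    have h1 : c₀ * m ^ K * (Nat.log 2 m + 1) ^ c₀ ≤ c₀ * ((3 * A) ^ K * 2 ^ γ) * (3 * A) ^ c₀ :=
      Nat.mul_le_mul (Nat.mul_le_mul_left _ hmK) hlogc
    have h2 : c₀ * ((3 * A) ^ K * 2 ^ γ) * (3 * A) ^ c₀ = c₀ * (3 * A) ^ (K + c₀) * 2 ^ γ := by
      rw [pow_add]; ring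
    have h3 : (3 * A) ^ (K + c₀) ≤ (3 * A) ^ e := Nat.pow_le_pow_right hA1 (by omega)
    have h4 : c₀ * (3 * A) ^ (K + c₀) * 2 ^ γ ≤ c₀ * (3 * A) ^ e * 2 ^ γ :=
      Nat.mul_le_mul_right _ (Nat.mul_le_mul_left _ h3)
    omega
  -- the table part
  have hTpart : 2 ^ (γ + 1) * (2 * N + 2) + 4 ≤ (3 * A) ^ e * 2 ^ γ + 4 := by
    have h1 : 2 ^ (γ + 1) * (2 * N + 2) = (4 * N + 4) * 2 ^ γ := by rw [pow_succ]; ring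
    have h2 : 4 * N + 4 ≤ 3 * A := by omega
    have h3 : 3 * A ≤ (3 * A) ^ e := by
      calc 3 * A = (3 * A) ^ 1 := (pow_one _).symm
        _ ≤ (3 * A) ^ e := Nat.pow_le_pow_right hA1 (by omega)
    rw [h1]
    have := Nat.mul_le_mul_right (2 ^ γ) (h2.trans h3)
    omega
  -- 3A ≤ (36 + 6 cP) N
  have h3A : 3 * A ≤ (36 + 6 * cP) * N := by
    have : 6 * cP ≤ 6 * cP * N := Nat.le_mul_of_pos_right _ hN
    nlinarith
  have h3Ae : (3 * A) ^ e ≤ (36 + 6 * cP) ^ e * N ^ e := by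
    rw [← mul_pow]; exact Nat.pow_le_pow_left h3A e
  have hNe : N ^ e ≤ N ^ c := Nat.pow_le_pow_right hN (by omega)
  have hce : (c₀ + 1) * (36 + 6 * cP) ^ e ≤ c := by omega
  -- assemble
  calc 2 ^ (γ + 1) * (2 * N + 2) + 4 + (c₀ * m ^ K * (Nat.log 2 m + 1) ^ c₀ + c₀)
      ≤ ((3 * A) ^ e * 2 ^ γ + 4) + (c₀ * (3 * A) ^ e * 2 ^ γ + c₀) := Nat.add_le_add hTpart hWpart
    _ = (c₀ + 1) * (3 * A) ^ e * 2 ^ γ + (c₀ + 4) := by ring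
    _ ≤ (c₀ + 1) * ((36 + 6 * cP) ^ e * N ^ e) * 2 ^ γ + (c₀ + 4) := by
        have := Nat.mul_le_mul_right (2 ^ γ) (Nat.mul_le_mul_left (c₀ + 1) h3Ae)
        omega
    _ = ((c₀ + 1) * (36 + 6 * cP) ^ e) * 2 ^ γ * N ^ e + (c₀ + 4) := by ring
    _ ≤ c * 2 ^ γ * N ^ c + c := by
        have h1 : ((c₀ + 1) * (36 + 6 * cP) ^ e) * 2 ^ γ * N ^ e ≤ c * 2 ^ γ * N ^ c :=
          Nat.mul_le_mul (Nat.mul_le_mul_right _ hce) hNe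
        omega


end LawArith

/-- **KERNEL: the PEREBOR LAW holds at every exponent `K`.**  `W_U ∈ SIZE(c₀ n^K (log n+1)^{c₀} + c₀)
⟹ KtEasy U (K/(K+1))`: for every threshold `s` one constant `c` with
`size(MKtP_U[s] ∩ {0,1}^N) ≤ c·2^{⌈K s(N)/(K+1)⌉}·N^c + c` for all `N`.  Cases: `N ≤ n₀` (Shannon
bound `univBound n₀`); `s(N) > 3N + c_print ≥ N + c_print + ⌈log₂ 2N⌉` (every string of length `N`
is in the slice by cheap printing `levinKt_le_length_add`: the constant circuit); otherwise the
TABLE ∪ PADDED-QUERY circuit `circuitSize_MKtP_le_of_W` at level `γ = ⌈K s(N)/(K+1)⌉` and the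
arithmetic `LawArith.total_le` (`m ≤ 2A·2^{s-γ}`, `m^K ≤ (3A)^K 2^γ` by `K(s-γ) ≤ γ`,
`log₂ m + 1 ≤ 3A`, `3A ≤ (36 + 6 c_print) N`).  0 sorry; this retires the binder `hlaw` of
`lift_of_timeLift` / `quadTimeRung_of_pereborAt` / `cornerLift_dominates` (corollaries below). -/
theorem pereborLaw_holds (K : ℕ) (U : UniversalMachine)
    (hWK : ∃ c : ℕ, W U ∈ SIZE (fun n => c * n ^ K * (Nat.log 2 n + 1) ^ c + c)) (s : ℕ → ℕ) :
    ∃ c : ℕ, U.MKtP s ∈ SIZE (pereborBound ((K : ℝ) / (K + 1)) s c) := by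
  obtain ⟨c₀, hW⟩ := hWK
  obtain ⟨cP, n₀, hprint⟩ := U.levinKt_le_length_add (ε := 1) one_pos
  obtain ⟨c, hBc, h1c, harith⟩ := LawArith.total_le K c₀ cP (univBound n₀)
  refine ⟨c, (mem_SIZE_iff_circuitSize_le_holds _ _).2 fun N => ?_⟩
  show (U.MKtP s).circuitSize N ≤ c * 2 ^ ⌈(K : ℝ) / (K + 1) * (s N : ℝ)⌉₊ * N ^ c + c
  have hc_le : c ≤ c * 2 ^ ⌈(K : ℝ) / (K + 1) * (s N : ℝ)⌉₊ * N ^ c + c := Nat.le_add_left c _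
  by_cases hN : N ≤ n₀
  · calc (U.MKtP s).circuitSize N ≤ univBound N := circuitSize_le_univBound _ _
      _ ≤ univBound n₀ := univBound_mono hN
      _ ≤ c := hBc
      _ ≤ _ := hc_le
  have hN1 : 1 ≤ N := by omega
  by_cases hσ : s N ≤ 3 * N + cP
  · -- the TABLE ∪ PADDED-QUERY circuit at level γ = ⌈K s/(K+1)⌉
    have hKσ : K * s N ≤ (K + 1) * ⌈(K : ℝ) / (K + 1) * (s N : ℝ)⌉₊ := LawArith.ceil_fact K (s N)
    exact (circuitSize_MKtP_le_of_W U s hW _ N).trans (harith N (s N) _ hN1 hσ hKσ)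
  · -- the trivial slice: every string of length N has Kt ≤ N + c_print + ⌈log₂ 2N⌉ ≤ 3N + c_print < s N
    have hall : ∀ x : List Bool, x.length = N → x ∈ U.MKtP s := by
      intro x hx
      have hx0 : n₀ ≤ x.length := by omega
      have h1 := hprint x hx0
      show U.levinKt x ≤ (s x.length : ℕ∞)
      refine h1.trans ?_
      rw [hx]
      have hceil : ⌈(1 + 1 : ℝ) * (N : ℝ)⌉₊ = 2 * N := by
        have e : (1 + 1 : ℝ) * (N : ℝ) = ((2 * N : ℕ) : ℝ) := by push_cast; ring
        rw [e, Nat.ceil_natCast]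
      have hclog : Nat.clog 2 (2 * N) ≤ 2 * N :=
        calc Nat.clog 2 (2 * N) ≤ Nat.clog 2 (2 ^ (2 * N)) :=
              Nat.clog_mono_right 2 (Nat.lt_two_pow_self).le
          _ = 2 * N := Nat.clog_pow 2 (2 * N) (by norm_num)
      rw [hceil]
      exact_mod_cast (show N + cP + Nat.clog 2 (2 * N) ≤ s N by omega)
    calc (U.MKtP s).circuitSize N ≤ 1 := circuitSize_le_one_of_forall_mem _ _ hall
      _ ≤ c := h1c
      _ ≤ _ := hc_le


end Summit.PneNP.PneNP.Theorems.RootDecompKtPereborPort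

namespace Summit.PneNP.PneNP.Theorems

/-- **The perebor law at `K = 2`** (stmt-PneNP-29375, `PereborLawTwo`): for every universal machine `U`,
if `W_U ∈ SIZE(c·n²·(log n+1)^c + c)` for some `c` then every threshold slice `MKtP_U[s]` has circuits
of size `c'·2^{⌈2s(N)/3⌉}·N^{c'} + c'`.  One-line instance of the ported kernel theorem
`RootDecompKtPereborPort.pereborLaw_holds 2` (decomp-pnenp cell, lens-3 g5; ported 2026-08-30). -/
theorem pereborLawTwo_proof :
    Summit.PneNP.PneNP.Theses.RootDecompKtPerebor.PereborLawTwo := by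
  unfold Summit.PneNP.PneNP.Theses.RootDecompKtPerebor.PereborLawTwo
  intro U hW s
  exact RootDecompKtPereborPort.pereborLaw_holds 2 U hW s

end Summit.PneNP.PneNP.Theorems
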